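import Summits.ValiantsHypothesis.ValiantsHypothesis.Theorems.BarrierLeverPartitionMinorsHitByVPSamePattern
import Summits.ValiantsHypothesis.ValiantsHypothesis.Theorems.BarrierLeverPartitionMinorsHitByVPOfLowerSets

/-!
# Route BarrierLever — item `PartitionMinorsHitByVP` (stmt-ValiantsHypothesis-19717):
# ALL MINORS OF CO-RANK ≤ 3 of the partition matrix are hit (`r ≥ 2^h − 3`, every layout)

Helper file (`--supports stmt-ValiantsHypothesis-19717`; cell valiant-natproofs, rung V4, 𝒟-side door (c); prover
seat val-np-p6 gen 6). Definition-free. Closes NO item. Extends `…HitByVPCorankOne` (same seat) from `r = 2^h − 1` to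
`r ∈ {2^h − 1, 2^h − 2, 2^h − 3}` by combining two landed pieces:

* `partitionMinor_hit_of_isoLowerSets` — **a reduction**: if ALL lower sets of a given size `r` in `2^{Fin h}` are
  pairwise related by a permutation of the coordinates, then EVERY injective layout with `r` rows is hit inside
  `SmallCircuits ℂ (h+h) 9` (`h ≥ 4`): val-np-p1 g12's lower-set reduction at fixed `r`
  (`DownCompression.exists_witness_of_lowerSets`) + this seat's «rows Δ × columns π(Δ)»
  (`partitionMinor_hit_samePattern_lowerSet_perm`, the peel of `…SamePattern`).
* `lowerSet_eq_univ_sdiff` / `isCoatom_of_mem_compl` — a lower set of size `2^h − k`, `1 ≤ k ≤ 3`, is «all subsets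
  except `univ` and `k − 1` co-atoms `univ.erase a`» (an up-set with at most `3` members cannot contain a set of
  co-dimension `≥ 2`), hence any two of the same size differ by a coordinate permutation (`iso_of_corank_le_three`).
* **`partitionMinor_hit_of_corank_le_three`** — for `h ≥ 4` and every injective layout `(u, w)` with
  `2^h − 3 ≤ r` (at most three subsets missing on each side, arbitrary, any orders), some `f ∈ SmallCircuits ℂ (h+h) 9`
  has a nonsingular partition minor.

WHAT THIS IS NOT: co-rank `4` already has two isomorphism types of lower sets («three co-atoms» vs «an interval»), which
this reduction does not relate; nothing on crux 14610 or VP vs VNP.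
-/

set_option linter.dupNamespace false

namespace Summit.ValiantsHypothesis.ValiantsHypothesis.Theorems.BarrierLever.FrobeniusDoor

open Finset MvPolynomial Matrix
open Literature.Barriers.ValiantsHypothesis Literature.Computability.AlgebraicComplexity
open Summit.ValiantsHypothesis.ValiantsHypothesis.Theorems.BarrierLever.AdditiveDoor
  (truncation_spec degree_partitionExpo_le)
open Summit.ValiantsHypothesis.ValiantsHypothesis.Theorems.BarrierLever.DownCompression
  (exists_witness_of_lowerSets size_le_pow)

noncomputable section

/-! ## 1. The reduction: pairwise-isomorphic lower sets of size `r` ⇒ every layout of size `r` is hit -/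

/-- **Reduction.** `h ≥ 4`; if any two injective lower-set families of size `r` are related by a coordinate permutation,
every injective layout with `r` rows is hit inside `SmallCircuits ℂ (h+h) 9`. -/
theorem partitionMinor_hit_of_isoLowerSets {h r : ℕ} (hh : 4 ≤ h)
    (hiso : ∀ v v' : Fin r → Finset (Fin h), Function.Injective v → Function.Injective v' →
      IsLowerSet (Set.range v) → IsLowerSet (Set.range v') →
      ∃ π : Equiv.Perm (Fin h), Set.range v' = Set.range fun i => (v i).map π.toEmbedding)
    (u w : Fin r → Finset (Fin h)) (hu : Function.Injective u) (hw : Function.Injective w) :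
    ∃ f ∈ SmallCircuits ℂ (h + h) 9,
      (Matrix.of fun i j : Fin r => MvPolynomial.coeff
        (∑ a ∈ u i, Finsupp.single (Fin.castAdd h a) 1 +
          ∑ c ∈ w j, Finsupp.single (Fin.natAdd h c) 1) f).det ≠ 0 := by
  have hh2 : 2 ≤ h := by omega
  have hyp : ∀ v w' : Fin r → Finset (Fin h), Function.Injective v → Function.Injective w' →
      IsLowerSet (Set.range v) → IsLowerSet (Set.range w') →
      ∃ f : MvPolynomial (Fin (h + h)) ℂ, complexity f ≤ (h + h) ^ 5 ∧ f.totalDegree ≤ h + h ∧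
        (Matrix.of fun i j : Fin r => MvPolynomial.coeff
          (∑ a ∈ v i, Finsupp.single (Fin.castAdd h a) 1 +
            ∑ c ∈ w' j, Finsupp.single (Fin.natAdd h c) 1) f).det ≠ 0 := by
    intro v w' hv hw' hlv hlw'
    obtain ⟨π, hπ⟩ := hiso v w' hv hw' hlv hlw'
    obtain ⟨f, ⟨hfd, hfs⟩, hf⟩ := partitionMinor_hit_samePattern_lowerSet_perm hh2 π v w' hv hw' hlv hπ
    exact ⟨f, hfs, hfd, hf⟩
  obtain ⟨g, hgs, hgd, hg⟩ := exists_witness_of_lowerSets ((h + h) ^ 5) (h + h) hyp u w hu hw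
  obtain ⟨hdeg, hcoeff, hsize⟩ := truncation_spec g (h + h)
  refine ⟨∑ k ∈ Finset.range (h + h + 1), homogeneousComponent k g, ⟨hdeg, ?_⟩, ?_⟩
  · calc complexity (∑ k ∈ Finset.range (h + h + 1), homogeneousComponent k g)
        ≤ (h + h + 2) ^ 2 * complexity g + (h + h + 1) := hsize
      _ ≤ (h + h + 2) ^ 2 * ((h + h) ^ 5 + 6 * h) + (h + h + 1) := by gcongr
      _ ≤ (h + h) ^ (5 + 4) := size_le_pow h 5 hh
  · have hmat : (Matrix.of fun i j : Fin r => MvPolynomial.coeff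
        (∑ a ∈ u i, Finsupp.single (Fin.castAdd h a) 1 +
          ∑ c ∈ w j, Finsupp.single (Fin.natAdd h c) 1)
        (∑ k ∈ Finset.range (h + h + 1), homogeneousComponent k g)) =
        Matrix.of fun i j : Fin r => MvPolynomial.coeff
          (∑ a ∈ u i, Finsupp.single (Fin.castAdd h a) 1 +
            ∑ c ∈ w j, Finsupp.single (Fin.natAdd h c) 1) g := by
      ext i j
      rw [Matrix.of_apply, Matrix.of_apply, hcoeff _ (degree_partitionExpo_le _ _)]
    rw [hmat]
    exact hg

/-! ## 2. Lower sets of co-rank `≤ 3` -/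

/-- In a lower set missing at most `3` subsets, every missing set other than `univ` is a co-atom `univ.erase a`
(the up-set of missing sets would otherwise contain the `4` sets `M ∪ X`, `X ⊆ {a, b}`, for two elements `a ≠ b`
outside `M`). -/
theorem isCoatom_of_not_mem_lowerSet {h r : ℕ} (v : Fin r → Finset (Fin h)) (hv : Function.Injective v)
    (hlow : IsLowerSet (Set.range v)) (hr : 2 ^ h ≤ r + 3) (M : Finset (Fin h)) (hM : M ∉ Set.range v)
    (hMu : M ≠ Finset.univ) : ∃ a : Fin h, M = Finset.univ.erase a := by
  classical
  obtain ⟨a, haM⟩ : ∃ a, a ∉ M := by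
    by_contra hcon; push Not at hcon
    exact hMu (Finset.eq_univ_of_forall hcon)
  refine ⟨a, ?_⟩
  by_contra hne
  -- some `b ≠ a` is also missing from `M`
  obtain ⟨b, hbM, hba⟩ : ∃ b, b ∉ M ∧ b ≠ a := by
    by_contra hcon; push Not at hcon
    apply hne
    ext x
    simp only [Finset.mem_erase, Finset.mem_univ, and_true]
    constructor
    · intro hx hxa; exact haM (hxa ▸ hx)
    · intro hxa; by_contra hx; exact hxa (hcon x hx)
  -- the missing sets form an up-set containing the four sets `M ∪ X`, `X ⊆ {a, b}`
  have hup : ∀ N, M ⊆ N → N ∉ Set.range v := fun N hMN hN => hM (hlow hMN hN)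
  set Q : Finset (Finset (Fin h)) := (({a, b} : Finset (Fin h)).powerset).image (fun X => M ∪ X) with hQ
  have hQcard : Q.card = 4 := by
    rw [hQ, Finset.card_image_of_injOn, Finset.card_powerset, Finset.card_pair hba.symm]
    · norm_num
    intro X hX X' hX' hXX'
    have hX : X ⊆ {a, b} := Finset.mem_powerset.mp hX
    have hX' : X' ⊆ {a, b} := Finset.mem_powerset.mp hX'
    have hdisj : ∀ Y : Finset (Fin h), Y ⊆ {a, b} → Disjoint M Y := by
      intro Y hY
      rw [Finset.disjoint_left]
      intro x hxM hxY
      rcases Finset.mem_insert.mp (hY hxY) with rfl | hx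
      · exact haM hxM
      · rw [Finset.mem_singleton] at hx; subst hx; exact hbM hxM
    have := congrArg (fun Z : Finset (Fin h) => Z \ M) hXX'
    simp only at this
    rwa [Finset.union_sdiff_cancel_left (hdisj X hX), Finset.union_sdiff_cancel_left (hdisj X' hX')] at this
  have hQsub : Q ⊆ Finset.univ \ Finset.univ.image v := by
    intro N hN
    rw [hQ, Finset.mem_image] at hN
    obtain ⟨X, -, rfl⟩ := hN
    rw [Finset.mem_sdiff, Finset.mem_image]
    refine ⟨Finset.mem_univ _, ?_⟩
    rintro ⟨i, -, hi⟩
    exact hup (M ∪ X) Finset.subset_union_left ⟨i, hi⟩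
  have hcard := Finset.card_le_card hQsub
  rw [hQcard, Finset.card_sdiff_of_subset (Finset.subset_univ _), Finset.card_univ, Fintype.card_finset, Fintype.card_fin,
    Finset.card_image_of_injective _ hv, Finset.card_univ, Fintype.card_fin] at hcard
  omega

/-- **Lower sets of co-rank `≤ 3` are «all but `univ` and some co-atoms»**: the range is
`{U : U ≠ univ ∧ ∀ a ∈ A, U ≠ univ.erase a}` for the finset `A` of removed coordinates. -/
theorem range_eq_of_corank_le_three {h r : ℕ} (v : Fin r → Finset (Fin h)) (hv : Function.Injective v)
    (hlow : IsLowerSet (Set.range v)) (hr : 2 ^ h ≤ r + 3) (hr' : r < 2 ^ h) :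
    ∃ A : Finset (Fin h), r + 1 + A.card = 2 ^ h ∧
      Set.range v = {U | U ≠ Finset.univ ∧ ∀ a ∈ A, U ≠ Finset.univ.erase a} := by
  classical
  have huniv : Finset.univ ∉ Set.range v := by
    intro hU
    have hall : ∀ S : Finset (Fin h), S ∈ Set.range v := fun S => hlow (Finset.subset_univ S) hU
    have : Fintype.card (Finset (Fin h)) ≤ Fintype.card (Fin r) :=
      Fintype.card_le_of_surjective v fun S => by obtain ⟨j, hj⟩ := hall S; exact ⟨j, hj⟩
    rw [Fintype.card_fin, Fintype.card_finset, Fintype.card_fin] at this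
    omega
  set A : Finset (Fin h) := Finset.univ.filter fun a => Finset.univ.erase a ∉ Set.range v with hA
  refine ⟨A, ?_, ?_⟩
  · -- count: the complement of the range is `{univ} ∪ {univ.erase a : a ∈ A}`
    have hcompl : (Finset.univ : Finset (Finset (Fin h))) \ Finset.univ.image v =
        insert Finset.univ (A.image fun a => Finset.univ.erase a) := by
      ext M
      simp only [Finset.mem_sdiff, Finset.mem_univ, true_and, Finset.mem_image, not_exists, Finset.mem_insert, hA,
        Finset.mem_filter]
      constructor
      · intro hM
        have hM' : M ∉ Set.range v := fun ⟨i, hi⟩ => hM i hi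
        by_cases hMu : M = Finset.univ
        · exact Or.inl hMu
        · obtain ⟨a, rfl⟩ := isCoatom_of_not_mem_lowerSet v hv hlow hr M hM' hMu
          exact Or.inr ⟨a, hM', rfl⟩
      · rintro (rfl | ⟨a, ha, rfl⟩)
        · exact fun i hi => huniv ⟨i, hi⟩
        · exact fun i hi => ha ⟨i, hi⟩
    have hc := congrArg Finset.card hcompl
    rw [Finset.card_sdiff_of_subset (Finset.subset_univ _), Finset.card_univ, Fintype.card_finset, Fintype.card_fin,
      Finset.card_image_of_injective _ hv, Finset.card_univ, Fintype.card_fin,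
      Finset.card_insert_of_notMem, Finset.card_image_of_injOn] at hc
    · omega
    · intro a _ b _ hab
      by_contra hne
      have hb : b ∈ Finset.univ.erase a := Finset.mem_erase.mpr ⟨fun h' => hne (h'.symm), Finset.mem_univ b⟩
      have hab' : (Finset.univ.erase a : Finset (Fin h)) = Finset.univ.erase b := hab
      rw [hab'] at hb
      exact Finset.notMem_erase b _ hb
    · rw [Finset.mem_image]; rintro ⟨a, -, ha⟩
      have hmem : a ∈ (Finset.univ : Finset (Fin h)) := Finset.mem_univ a
      have ha' : (Finset.univ.erase a : Finset (Fin h)) = Finset.univ := ha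
      rw [← ha'] at hmem
      exact Finset.notMem_erase a _ hmem
  · ext U
    simp only [Set.mem_setOf_eq, hA, Finset.mem_filter, Finset.mem_univ, true_and]
    constructor
    · rintro ⟨i, rfl⟩
      refine ⟨fun hU => huniv ⟨i, hU⟩, fun a ha hUa => ha ⟨i, hUa⟩⟩
    · rintro ⟨hU, hUA⟩
      by_contra hnot
      rcases isCoatom_of_not_mem_lowerSet v hv hlow hr U hnot hU with ⟨a, rfl⟩
      exact hUA a hnot rfl

/-- Two lower sets of the same co-rank `≤ 3` differ by a coordinate permutation. -/
theorem iso_of_corank_le_three {h r : ℕ} (hr : 2 ^ h ≤ r + 3) (hr' : r < 2 ^ h)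
    (v v' : Fin r → Finset (Fin h)) (hv : Function.Injective v) (hv' : Function.Injective v')
    (hlv : IsLowerSet (Set.range v)) (hlv' : IsLowerSet (Set.range v')) :
    ∃ π : Equiv.Perm (Fin h), Set.range v' = Set.range fun i => (v i).map π.toEmbedding := by
  classical
  obtain ⟨A, hA, hvA⟩ := range_eq_of_corank_le_three v hv hlv hr hr'
  obtain ⟨A', hA', hvA'⟩ := range_eq_of_corank_le_three v' hv' hlv' hr hr'
  have hcardA : A.card = A'.card := by omega
  -- a permutation of `Fin h` carrying `A` onto `A'`
  obtain ⟨e⟩ : Nonempty (A ≃ A') := Fintype.card_eq.mp (by simp [hcardA])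
  obtain ⟨π, hπ⟩ : ∃ π : Equiv.Perm (Fin h), ∀ a : A, π a = e a := ⟨e.extendSubtype, fun a => e.extendSubtype_apply_of_mem _ a.2⟩
  have hπA : ∀ a, a ∈ A ↔ π a ∈ A' := by
    intro a
    constructor
    · intro ha; rw [hπ ⟨a, ha⟩]; exact (e ⟨a, ha⟩).2
    · intro hπa
      by_contra ha
      -- `π` maps `Aᶜ` into `A'ᶜ` by counting: `π` restricted to `A` is onto `A'`
      have hsurj : ∀ b ∈ A', ∃ a ∈ A, π a = b := fun b hb =>
        ⟨(e.symm ⟨b, hb⟩).1, (e.symm ⟨b, hb⟩).2, by rw [hπ]; simp⟩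
      obtain ⟨a₀, ha₀, hπa₀⟩ := hsurj _ hπa
      exact ha ((π.injective hπa₀) ▸ ha₀)
  refine ⟨π, ?_⟩
  rw [hvA']
  ext U
  simp only [Set.mem_setOf_eq, Set.mem_range]
  constructor
  · rintro ⟨hU, hUA'⟩
    -- `U = (π⁻¹ U).map π` with `π⁻¹ U` in the range of `v`
    have hpre : U.map π.symm.toEmbedding ∈ Set.range v := by
      rw [hvA]
      refine ⟨fun hEq => hU ?_, fun a ha hEq => hUA' (π a) ((hπA a).mp ha) ?_⟩
      · have := congrArg (Finset.map π.toEmbedding) hEq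
        rw [Finset.map_map] at this
        simpa [Finset.map_univ_equiv] using this
      · have := congrArg (Finset.map π.toEmbedding) hEq
        rw [Finset.map_map, Finset.map_erase, Finset.map_univ_equiv] at this
        simpa using this
    obtain ⟨i, hi⟩ := hpre
    refine ⟨i, ?_⟩
    rw [hi, Finset.map_map]
    convert Finset.map_refl (s := U) using 2; ext x; simp
  · rintro ⟨i, rfl⟩
    have hvi : v i ∈ Set.range v := ⟨i, rfl⟩
    rw [hvA] at hvi
    obtain ⟨hU, hUA⟩ := hvi
    refine ⟨fun hEq => hU ?_, fun a' ha' hEq => ?_⟩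
    · have := congrArg (Finset.map π.symm.toEmbedding) hEq
      rw [Finset.map_map, Finset.map_univ_equiv] at this
      simpa using this
    · have ha : π.symm a' ∈ A := by rw [hπA]; simpa using ha'
      apply hUA _ ha
      have := congrArg (Finset.map π.symm.toEmbedding) hEq
      rw [Finset.map_map, Finset.map_erase, Finset.map_univ_equiv] at this
      simpa using this

/-! ## 3. All minors of co-rank `≤ 3` -/

/-- **ALL PARTITION MINORS OF CO-RANK ≤ 3 ARE HIT.** `h ≥ 4`; for every injective layout `(u, w)` with `2^h ≤ r + 3`
(each side misses at most three subsets, arbitrary, in any orders) some `f ∈ SmallCircuits ℂ (h+h) 9` has a nonsingular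
partition minor. -/
theorem partitionMinor_hit_of_corank_le_three {h r : ℕ} (hh : 4 ≤ h) (hr : 2 ^ h ≤ r + 3)
    (u w : Fin r → Finset (Fin h)) (hu : Function.Injective u) (hw : Function.Injective w) :
    ∃ f ∈ SmallCircuits ℂ (h + h) 9,
      (Matrix.of fun i j : Fin r => MvPolynomial.coeff
        (∑ a ∈ u i, Finsupp.single (Fin.castAdd h a) 1 +
          ∑ c ∈ w j, Finsupp.single (Fin.natAdd h c) 1) f).det ≠ 0 := by
  classical
  by_cases hr' : r < 2 ^ h
  · exact partitionMinor_hit_of_isoLowerSets hh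
      (fun v v' hv hv' hlv hlv' => iso_of_corank_le_three hr hr' v v' hv hv' hlv hlv') u w hu hw
  · -- `r = 2^h`: both families are everything, hence lower sets with equal ranges
    have hr2 : r = 2 ^ h := by
      have := Fintype.card_le_of_injective u hu
      rw [Fintype.card_fin, Fintype.card_finset, Fintype.card_fin] at this
      omega
    have hsurj : ∀ (v : Fin r → Finset (Fin h)), Function.Injective v → Set.range v = Set.univ := by
      intro v hv
      have hb : Function.Bijective v := by
        rw [Fintype.bijective_iff_injective_and_card]
        exact ⟨hv, by rw [Fintype.card_fin, Fintype.card_finset, Fintype.card_fin, hr2]⟩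
      exact Set.range_eq_univ.mpr hb.2
    have hh2 : 2 ≤ h := by omega
    obtain ⟨f, ⟨hfd, hfs⟩, hf⟩ := partitionMinor_hit_samePattern_lowerSet hh2 u w hu hw
      (by rw [hsurj u hu, hsurj w hw]) (by rw [hsurj u hu]; exact isLowerSet_univ)
    refine ⟨f, ⟨hfd, hfs.trans ?_⟩, hf⟩
    exact Nat.pow_le_pow_right (by omega) (by norm_num)

end

end Summit.ValiantsHypothesis.ValiantsHypothesis.Theorems.BarrierLever.FrobeniusDoor
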